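import Literature.MathematicalPhysics.QuantumFieldTheory.Balaban1983to89.B9Thm39Sum

/-!
# `Balaban1983to89.B9Thm39CinvSepMiddle` — [4] (2.83)–(2.85) WITH THE SEPARATION IN THE MIDDLE: a product `M_f·L·M_m·T` of two block-majorised operators whose
# left rows (`supp f`) are `≥ D_sep` away from the blocks where the middle cut-off `m` lives gains `e^{−a_sep δ₀ D_sep}`, with INDEPENDENT weights on the
# two factors paired by one scale-transfer inequality — the generic estimate behind the cube-side defect majorant of p21's M5.6 fourth sum
# (sub-row G-B9-LETTERS, module M5.2-E, FILE E2-3b-i; r06's `B9Thm39CinvFirstSum.firstSum_term_majorant_blk` is the LEFT-separated sibling)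

T. Bałaban, *Propagators for lattice gauge theories in a background field*, Commun. Math. Phys. **99** (1985) 389–434
[`Balaban1985BackgroundPropagators`, "B9"]; [4] = T. Bałaban, *Propagators and renormalization transformations for lattice gauge
theories. II*, Commun. Math. Phys. **96** (1984) 223–250 [`Balaban1984PropagatorsII`].

statement-level skeleton of published theorems with citation tags; proofs where landed; nothing here is a claim about the
Yang–Mills mass gap

THE PRINTED LOCUS.  [B9] (3.95)–(3.96) p. 411: *«By the same estimates as in [4], especially (2.83)-(2.85), we can see that the operator R is small»*; p. 412
l. 31–36: *«… can be estimated by the usual factors multiplied by e^{−2δ₀M}. We have to notice only that the operators may differ outside □̃₀, and the distance from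
□̃ to □̃₀ is at least M»*; [4] (2.83)–(2.85) pp. 237–238 (the partial estimates), (2.52)–(2.55) p. 232 (composition of block majorants), Lemma 2.1 (2.61) p. 234,
and the p. 398 scale transfer of [B9] (`e^{−αδ₀d(y,y′)}w(y′) ≦ C·w(y)`).

WHY THIS FILE.  p21's M5.6 defect edition carries a fourth sum whose □-term is, on the cube side (FILE E2-3a `B9Cor36CinvCubeLocDefectTransfer`), the operator
`1_S·[X̂·(1 − 1_N) + Q′_□G′_□·(1 − M_χ²)·G′_□Q′_□\*·1_N]·Ĉ·1_S`: in BOTH parts the smallness comes from a cut-off in the MIDDLE of a product (`1 − 1_N` between `X̂` and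
`Ĉ`; `1 − χ²` between the two `G′_□`) whose support is `≥ D_sep` away from the ROWS let through by the left cut-off `1_S` — while r06's generic (2.83) lemma
`firstSum_term_majorant_blk` separates the LEFT cut-off from a two-sided localized right factor.  THIS FILE proves the middle-separated sibling, with the two
factors' weights decoupled (`w_L(a)` on the left kernel, `w_T(y″)` on the right kernel, paired by ONE scale-transfer inequality `e^{−α_st δ₀ d(a,y″)}w_T(y″) ≦ C·w_A(a)`),
so that it serves the pairs `(X̂, Ĉ)` (`w_L = ℓ⁴`, `w_T = ℓ⁻⁴`, `w_A = ℓ⁻⁴`) and `(G′_□, G′_□)` (`w_L = w_T = w_A = ℓ²`) alike: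
* ★★ `sepMiddle_majorant_blk`: `L ≺ κ·w_L(a)·e^{−a_Lδ₀d}`, `T ≺ B₀·w_T(y″)·e^{−bδ₀d}`, `|f|, |m| ≦ 1`, `supp f ⊂ blk⁻¹(S_f)`, `supp m ⊂ blk⁻¹(Z)`, `d(S_f, Z) ≧ D_sep`,
  `α_st + a_sep + ρ ≦ a_L`, (2.54), (2.61) at `b − ρ` ⟹ `M_f·L·M_m·T ≺ 𝟙_{S_f}(a)·κB₀C·c₁·e^{−a_sepδ₀D_sep}·w_L(a)w_A(a)·e^{−ρδ₀d(a,b′)}`.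
* ★ `sepMiddle_majorant_blk₀`: the same without separation (`D_sep = 0`): the plain weight-pairing product estimate.

HONEST SCOPE.  Real-analysis bookkeeping over an abstract [B9] Sect. A geometry and block map (no lattice object is constructed); (2.54), (2.61) and the scale transfer
are HYPOTHESES (discharged for the member by `B9GeoLemma21KLevelV1`, for the cube sequence by p33's `B9CubeGeometryInputs`).  Count-neutral; no summit ∕
sub-problem statement is proved; nothing continuum ∕ OS ∕ mass-gap ∕ Clay.  No `sorry`, no `axiom`, no `… : Prop` fact, no `instance`, no `notation`, no `def`.
NEW file; nothing landed is modified.  Cell `lit-balaban`, seat `lit-balaban-p21` gen 34, 2026-08-28; `--supports stmt-QuantumFields-19200` as helper.  Net new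
unproved facts: 0.

RELATED IN THE TREE, NOT DUPLICATED (searched 2026-08-28: `lean search 'sepMiddle'` = ∅; `firstSum_term_majorant` = r06's two): r06 `B9Thm39CinvFirstSum`
(left-separated sibling, same arithmetic — proof adapted from it), `B9Thm39Sum` (`hasMajorant_mulOp_cut`), p38∕p21 `B9Thm37Sum` (`mulOp`), pv08 `B6RandomWalk`
(`HasMajorant`, `hasMajorant_mul`, `Ineq261`, `Triangle254`, `c1`) — USED BY NAME; no existing module modified.
-/

namespace Literature.MathematicalPhysics.QuantumFieldTheory.Balaban1983to89.B9Thm39CinvSepMiddle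

open Literature.MathematicalPhysics.QuantumFieldTheory.Balaban1983to89
open Finset

variable {g : B9.Geometry} [Fintype g.Site] [DecidableEq g.Site] {R : ℝ} {H : Prop} {X : Type}

/-- a middle cut-off supported over `Z` localizes the ROWS of the right factor: `M_m·T ≺ 𝟙_Z(y″)·K_T(y″, b′)`.
[cite: Balaban1984PropagatorsII, (2.52) p.232; Balaban1985BackgroundPropagators, (3.95) p.411, bookkeeping] -/
theorem hasMajorant_mulOp_rows (blk : X → g.Site) {T : Module.End ℝ (X → ℝ)} {K : g.Site → g.Site → ℝ}
    (hT : B6RandomWalk.HasMajorant (g := B9Thm34Ext.toB6 g R H) blk T K) (m : X → ℝ) (hm1 : ∀ x, |m x| ≤ 1)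
    (Z : Finset g.Site) (hm0 : ∀ x, blk x ∉ Z → m x = 0) :
    B6RandomWalk.HasMajorant (g := B9Thm34Ext.toB6 g R H) blk (B9Thm37Sum.mulOp m * T)
      (fun (y'' b' : g.Site) => (if y'' ∈ Z then (1 : ℝ) else 0) * K y'' b') := by
  have h := B9Thm39Sum.hasMajorant_mulOp_cut (R := R) (H := H) blk hT m hm1 (Finset.univ \ Z)
    (fun x hx => hm0 x (Finset.mem_sdiff.1 hx).2)
  refine B6RandomWalk.hasMajorant_mono (g := B9Thm34Ext.toB6 g R H) _ h fun (a b' : g.Site) => le_of_eq ?_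
  by_cases ha : a ∈ Z
  · simp [ha]
  · simp [ha]

/-- ★★ **[4] (2.83) WITH THE SEPARATION IN THE MIDDLE.**  `L ≺ κ·w_L(a)·e^{−a_Lδ₀d(a,y″)}`, `T ≺ B₀·w_T(y″)·e^{−bδ₀d(y″,b′)}` (`κ, B₀ ≧ 0`, `w_T ≧ 0`), cut-offs `|f|, |m| ≦ 1`
with `supp f ⊂ blk⁻¹(S_f)`, `supp m ⊂ blk⁻¹(Z)` and `d(a, y″) ≧ D_sep` for `a ∈ S_f`, `y″ ∈ Z`; the scale transfer `e^{−α_stδ₀d(a,y″)}w_T(y″) ≦ C·w_A(a)`, (2.54),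
(2.61) at `b − ρ`, and `α_st + a_sep + ρ ≦ a_L`, `a_sep, ρ, δ₀ ≧ 0`.  Then
  `M_f·L·M_m·T ≺ 𝟙_{S_f}(a)·(κB₀C·c₁(δ₀, b − ρ)·e^{−a_sepδ₀D_sep})·(w_L(a)·w_A(a))·e^{−ρδ₀d(a,b′)}`.
Proof = r06's `firstSum_term_majorant_blk` with the separated variable moved to the middle: split `e^{−a_Ld(a,y″)}` into the `α_st`-part (absorbed with `w_T(y″)` by the
scale transfer), the `a_sep`-part (`≦ e^{−a_sepδ₀D_sep}` on the support of `m`), and the `ρ`-part (triangle inequality through `y″`), then sum `y″` by (2.61).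
[cite: Balaban1984PropagatorsII, (2.83)–(2.85) pp.237–238, (2.52)–(2.55) p.232, (2.61) p.234; Balaban1985BackgroundPropagators, (3.95) p.411, p.412 l.31–36, p.398] -/
theorem sepMiddle_majorant_blk (blk : X → g.Site) (d : ℕ) (δ₀ aL αst asep ρ b κ B₀ C Dsep : ℝ) (wL wT wA : g.Site → ℝ)
    (Sf Z : Finset g.Site) (f m : X → ℝ)
    (hκ : 0 ≤ κ) (hB₀ : 0 ≤ B₀) (hC : 0 ≤ C) (hwL : ∀ y, 0 ≤ wL y) (hwT : ∀ y, 0 ≤ wT y) (hwA : ∀ y, 0 ≤ wA y) (hδ₀ : 0 ≤ δ₀)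
    (hasep : 0 ≤ asep) (hρ : 0 ≤ ρ) (hsplit : αst + asep + ρ ≤ aL)
    (htri : B6RandomWalk.Triangle254 (B9Thm34Ext.toB6 g R H)) (hsymm : ∀ a b : g.Site, g.dist a b = g.dist b a)
    (hdnn : ∀ a b : g.Site, 0 ≤ g.dist a b)
    (hST : ∀ a y'' : g.Site, Real.exp (-(αst * δ₀ * g.dist a y'')) * wT y'' ≤ C * wA a)
    (h261 : B6RandomWalk.Ineq261 d (B9Thm34Ext.toB6 g R H) δ₀ (b - ρ))
    (hf1 : ∀ x, |f x| ≤ 1) (hf0 : ∀ x, blk x ∉ Sf → f x = 0) (hm1 : ∀ x, |m x| ≤ 1) (hm0 : ∀ x, blk x ∉ Z → m x = 0)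
    (hsep : ∀ a ∈ Sf, ∀ y'' ∈ Z, Dsep ≤ g.dist a y'')
    {Lop T : Module.End ℝ (X → ℝ)}
    (hL : B6RandomWalk.HasMajorant (g := B9Thm34Ext.toB6 g R H) blk Lop
      (fun (a y'' : g.Site) => κ * wL a * Real.exp (-(aL * δ₀ * g.dist a y''))))
    (hT : B6RandomWalk.HasMajorant (g := B9Thm34Ext.toB6 g R H) blk T
      (fun (y'' b' : g.Site) => B₀ * wT y'' * Real.exp (-(b * δ₀ * g.dist y'' b')))) :
    B6RandomWalk.HasMajorant (g := B9Thm34Ext.toB6 g R H) blk (B9Thm37Sum.mulOp f * Lop * B9Thm37Sum.mulOp m * T)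
      (fun (a b' : g.Site) => (if a ∈ Sf then (1 : ℝ) else 0) *
        (κ * B₀ * C * B6.c1 d δ₀ (b - ρ) * Real.exp (-(asep * δ₀ * Dsep))) * (wL a * wA a) * Real.exp (-(ρ * δ₀ * g.dist a b'))) := by
  -- rows of `T` localized by the middle cut-off
  have hmT := hasMajorant_mulOp_rows (R := R) (H := H) blk hT m hm1 Z hm0
  have hK₂ : ∀ y'' b' : g.Site, 0 ≤ (if y'' ∈ Z then (1 : ℝ) else 0) * (B₀ * wT y'' * Real.exp (-(b * δ₀ * g.dist y'' b'))) := fun y'' b' =>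
    mul_nonneg (by split_ifs <;> norm_num) (mul_nonneg (mul_nonneg hB₀ (hwT y'')) (Real.exp_nonneg _))
  have hLT := B6RandomWalk.hasMajorant_mul (g := B9Thm34Ext.toB6 g R H) blk hL hmT hK₂
  have hcut := B9Thm39Sum.hasMajorant_mulOp_cut (R := R) (H := H) blk hLT f hf1 (Finset.univ \ Sf)
    (fun x hx => hf0 x (Finset.mem_sdiff.1 hx).2)
  rw [show B9Thm37Sum.mulOp f * Lop * B9Thm37Sum.mulOp m * T = B9Thm37Sum.mulOp f * (Lop * (B9Thm37Sum.mulOp m * T)) by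
    simp only [mul_assoc]]
  refine B6RandomWalk.hasMajorant_mono (g := B9Thm34Ext.toB6 g R H) _ hcut fun (a b' : g.Site) => ?_
  by_cases ha : a ∈ Sf
  swap
  · have hnot : a ∈ Finset.univ \ Sf := Finset.mem_sdiff.2 ⟨Finset.mem_univ _, ha⟩
    simp [ha, hnot]
  have hnot : a ∉ Finset.univ \ Sf := fun h => (Finset.mem_sdiff.1 h).2 ha
  simp only [hnot, if_false, one_mul, ha, if_true]
  have hcoefρ : 0 ≤ ρ * δ₀ := mul_nonneg hρ hδ₀
  have hΘ0 : 0 ≤ κ * B₀ * C * Real.exp (-(asep * δ₀ * Dsep)) * (wL a * wA a) :=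
    mul_nonneg (mul_nonneg (mul_nonneg (mul_nonneg hκ hB₀) hC) (Real.exp_nonneg _)) (mul_nonneg (hwL a) (hwA a))
  have hterm : ∀ y'' : g.Site,
      κ * wL a * Real.exp (-(aL * δ₀ * g.dist a y'')) *
          ((if y'' ∈ Z then (1 : ℝ) else 0) * (B₀ * wT y'' * Real.exp (-(b * δ₀ * g.dist y'' b')))) ≤
        κ * B₀ * C * Real.exp (-(asep * δ₀ * Dsep)) * (wL a * wA a) *
          Real.exp (-(ρ * δ₀ * g.dist a b')) * Real.exp (-((b - ρ) * δ₀ * g.dist b' y'')) := by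
    intro y''
    by_cases hy'' : y'' ∈ Z
    · simp only [hy'', if_true, one_mul]
      have hsplitexp : Real.exp (-(aL * δ₀ * g.dist a y'')) ≤
          Real.exp (-(αst * δ₀ * g.dist a y'')) * Real.exp (-(asep * δ₀ * g.dist a y'')) *
            Real.exp (-(ρ * δ₀ * g.dist a y'')) := by
        rw [← Real.exp_add, ← Real.exp_add]
        refine Real.exp_le_exp.mpr ?_
        have h1 := mul_le_mul_of_nonneg_right hsplit (mul_nonneg hδ₀ (hdnn a y''))
        nlinarith [h1]
      have hst : Real.exp (-(αst * δ₀ * g.dist a y'')) * wT y'' ≤ C * wA a := hST a y''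
      have hsepexp : Real.exp (-(asep * δ₀ * g.dist a y'')) ≤ Real.exp (-(asep * δ₀ * Dsep)) := by
        refine Real.exp_le_exp.mpr ?_
        have h1 := mul_le_mul_of_nonneg_left (hsep a ha y'' hy'') (mul_nonneg hasep hδ₀)
        linarith
      have htri' : Real.exp (-(ρ * δ₀ * g.dist a y'')) * Real.exp (-(b * δ₀ * g.dist y'' b')) ≤
          Real.exp (-(ρ * δ₀ * g.dist a b')) * Real.exp (-((b - ρ) * δ₀ * g.dist b' y'')) := by
        rw [← Real.exp_add, ← Real.exp_add]
        refine Real.exp_le_exp.mpr ?_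
        have h0 : g.dist a b' ≤ g.dist a y'' + g.dist y'' b' := htri a y'' b'
        have h1 := mul_le_mul_of_nonneg_left h0 hcoefρ
        rw [hsymm b' y'']
        nlinarith [h1]
      have hκB : 0 ≤ κ * B₀ * wL a := mul_nonneg (mul_nonneg hκ hB₀) (hwL a)
      calc κ * wL a * Real.exp (-(aL * δ₀ * g.dist a y'')) * (B₀ * wT y'' * Real.exp (-(b * δ₀ * g.dist y'' b')))
          = Real.exp (-(aL * δ₀ * g.dist a y'')) * (κ * B₀ * wL a * wT y'' * Real.exp (-(b * δ₀ * g.dist y'' b'))) := by ring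
        _ ≤ Real.exp (-(αst * δ₀ * g.dist a y'')) * Real.exp (-(asep * δ₀ * g.dist a y'')) *
              Real.exp (-(ρ * δ₀ * g.dist a y'')) * (κ * B₀ * wL a * wT y'' * Real.exp (-(b * δ₀ * g.dist y'' b'))) :=
            mul_le_mul_of_nonneg_right hsplitexp
              (mul_nonneg (mul_nonneg hκB (hwT y'')) (Real.exp_nonneg _))
        _ = κ * B₀ * wL a * (Real.exp (-(αst * δ₀ * g.dist a y'')) * wT y'') * Real.exp (-(asep * δ₀ * g.dist a y'')) *
              (Real.exp (-(ρ * δ₀ * g.dist a y'')) * Real.exp (-(b * δ₀ * g.dist y'' b'))) := by ring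
        _ ≤ κ * B₀ * wL a * (C * wA a) * Real.exp (-(asep * δ₀ * Dsep)) *
              (Real.exp (-(ρ * δ₀ * g.dist a b')) * Real.exp (-((b - ρ) * δ₀ * g.dist b' y''))) := by
            refine mul_le_mul ?_ htri' (mul_nonneg (Real.exp_nonneg _) (Real.exp_nonneg _)) ?_
            · exact mul_le_mul (mul_le_mul_of_nonneg_left hst hκB) hsepexp (Real.exp_nonneg _)
                (mul_nonneg hκB (mul_nonneg hC (hwA a)))
            · exact mul_nonneg (mul_nonneg hκB (mul_nonneg hC (hwA a))) (Real.exp_nonneg _)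
        _ = _ := by ring
    · simp only [hy'', if_false, zero_mul, mul_zero]
      exact mul_nonneg (mul_nonneg hΘ0 (Real.exp_nonneg _)) (Real.exp_nonneg _)
  calc ∑ y'' : g.Site, κ * wL a * Real.exp (-(aL * δ₀ * g.dist a y'')) *
          ((if y'' ∈ Z then (1 : ℝ) else 0) * (B₀ * wT y'' * Real.exp (-(b * δ₀ * g.dist y'' b'))))
      ≤ ∑ y'' : g.Site, κ * B₀ * C * Real.exp (-(asep * δ₀ * Dsep)) * (wL a * wA a) *
          Real.exp (-(ρ * δ₀ * g.dist a b')) * Real.exp (-((b - ρ) * δ₀ * g.dist b' y'')) :=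
        Finset.sum_le_sum fun y'' _ => hterm y''
    _ = κ * B₀ * C * Real.exp (-(asep * δ₀ * Dsep)) * (wL a * wA a) *
          Real.exp (-(ρ * δ₀ * g.dist a b')) * ∑ y'' : g.Site, Real.exp (-((b - ρ) * δ₀ * g.dist b' y'')) := by
        rw [Finset.mul_sum]
    _ ≤ κ * B₀ * C * Real.exp (-(asep * δ₀ * Dsep)) * (wL a * wA a) *
          Real.exp (-(ρ * δ₀ * g.dist a b')) * B6.c1 d δ₀ (b - ρ) :=
        mul_le_mul_of_nonneg_left (h261 b') (mul_nonneg hΘ0 (Real.exp_nonneg _))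
    _ = _ := by ring

/-- ★ **THE WEIGHT-PAIRING PRODUCT ESTIMATE WITHOUT SEPARATION** (`D_sep = 0`): `M_f·L·M_m·T ≺ 𝟙_{S_f}(a)·κB₀C·c₁(δ₀, b − ρ)·w_L(a)w_A(a)·e^{−ρδ₀d(a,b′)}`
under the same hypotheses minus the separation. [cite: Balaban1984PropagatorsII, (2.52)–(2.55) p.232, (2.61) p.234; Balaban1985BackgroundPropagators, (3.95) p.411, p.398] -/
theorem sepMiddle_majorant_blk₀ (blk : X → g.Site) (d : ℕ) (δ₀ aL αst asep ρ b κ B₀ C : ℝ) (wL wT wA : g.Site → ℝ)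
    (Sf Z : Finset g.Site) (f m : X → ℝ)
    (hκ : 0 ≤ κ) (hB₀ : 0 ≤ B₀) (hC : 0 ≤ C) (hwL : ∀ y, 0 ≤ wL y) (hwT : ∀ y, 0 ≤ wT y) (hwA : ∀ y, 0 ≤ wA y) (hδ₀ : 0 ≤ δ₀)
    (hasep : 0 ≤ asep) (hρ : 0 ≤ ρ) (hsplit : αst + asep + ρ ≤ aL)
    (htri : B6RandomWalk.Triangle254 (B9Thm34Ext.toB6 g R H)) (hsymm : ∀ a b : g.Site, g.dist a b = g.dist b a)
    (hdnn : ∀ a b : g.Site, 0 ≤ g.dist a b)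
    (hST : ∀ a y'' : g.Site, Real.exp (-(αst * δ₀ * g.dist a y'')) * wT y'' ≤ C * wA a)
    (h261 : B6RandomWalk.Ineq261 d (B9Thm34Ext.toB6 g R H) δ₀ (b - ρ))
    (hf1 : ∀ x, |f x| ≤ 1) (hf0 : ∀ x, blk x ∉ Sf → f x = 0) (hm1 : ∀ x, |m x| ≤ 1) (hm0 : ∀ x, blk x ∉ Z → m x = 0)
    {Lop T : Module.End ℝ (X → ℝ)}
    (hL : B6RandomWalk.HasMajorant (g := B9Thm34Ext.toB6 g R H) blk Lop
      (fun (a y'' : g.Site) => κ * wL a * Real.exp (-(aL * δ₀ * g.dist a y''))))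
    (hT : B6RandomWalk.HasMajorant (g := B9Thm34Ext.toB6 g R H) blk T
      (fun (y'' b' : g.Site) => B₀ * wT y'' * Real.exp (-(b * δ₀ * g.dist y'' b')))) :
    B6RandomWalk.HasMajorant (g := B9Thm34Ext.toB6 g R H) blk (B9Thm37Sum.mulOp f * Lop * B9Thm37Sum.mulOp m * T)
      (fun (a b' : g.Site) => (if a ∈ Sf then (1 : ℝ) else 0) *
        (κ * B₀ * C * B6.c1 d δ₀ (b - ρ)) * (wL a * wA a) * Real.exp (-(ρ * δ₀ * g.dist a b'))) := by
  have h := sepMiddle_majorant_blk (R := R) (H := H) blk d δ₀ aL αst asep ρ b κ B₀ C 0 wL wT wA Sf Z f m hκ hB₀ hC hwL hwT hwA hδ₀ hasep hρ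
    hsplit htri hsymm hdnn hST h261 hf1 hf0 hm1 hm0 (fun a _ y'' _ => hdnn a y'') hL hT
  refine B6RandomWalk.hasMajorant_mono (g := B9Thm34Ext.toB6 g R H) _ h fun (a b' : g.Site) => le_of_eq ?_
  rw [mul_zero, neg_zero, Real.exp_zero, mul_one]

end Literature.MathematicalPhysics.QuantumFieldTheory.Balaban1983to89.B9Thm39CinvSepMiddle
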